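import Literature.Topology.FourManifolds.CappellShanesonClassGroupSeventythreeMain
import HarnessLib

/-!
# Trace `73`: Gompf's conjecture REDUCED to Iwaki's four undecided special classes `(178, 191, 73)`, `(23, 145, 73)`, `(41, 189, 73)`, `(23, 171, 73)`

The trace `73` is covered neither by Kim–Yamada's Theorem B (`[-64, 69]`, tree: `CappellShanesonThmBWindow.lean`)
nor by Iwaki's Theorem 5.1 (`-73, -69, -67, -66, 71, 72, 74, 78`, tree: `CappellShanesonIwakiWindow.lean`).  K. Iwaki,
*Infinite families of standard Cappell–Shaneson homotopy 4-spheres*, Topology Appl. 366 (2025) 109293 =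
arXiv:2404.05096, §4.3 lists the `38` ideal classes of `ℤ[θ₇₃]` (MAGMA; certified in
`…ClassGroupSeventythree{,Rel1,Rel2,Rel3,Cls,Main}.lean`), and §5.1 explains the procedure behind Theorem 5.1: a
representative `(c, d, n)` with `n ≡ n₀ (mod d)` for a trace `n₀` where Gompf's conjecture is known moves to `A₀` by one
Gompf move (Lemma 5.2 = Kim–Yamada's Lemma 6.1); the remaining, "special", classes are treated one by one by printed
chains — none of which concerns the trace `73` ("if it is uncertain whether or not a special `(c,d,n)` is equivalent to
`(1,1,2)`, such `(c,d,n)` are double underlined").  For the row `n = 73` exactly four classes are special: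
`(178, 191, 73)`, `(23, 145, 73)`, `(41, 189, 73)`, `(23, 171, 73)` (a Gompf move changes the trace by a multiple of `d`;
the nearest candidates `73 - d = -118, -72, -116, -98` are not among the traces where the conjecture is known).  This file runs the procedure over the certified cover
`isConj_standardCSMatrix_of_trace_eq_seventythree` and proves:

* `gompfConjectureForTrace_seventythree_of` — the inductive-step form (hypotheses: Gompf's conjecture at the smaller
  traces met by the moves, all theorems of the tree, and the Gompf equivalence of the four special standard matrices
  with `A₀`);
* `gompfConjectureForTrace_seventythree_of_undecided` — **`GompfConjectureForTrace 73` from the four undecided classes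
  alone**, and `gompfConjectureForTrace_seventythree_iff` (the converse is trivial); the mirror `-68 = 5 - 73` by
  Kim–Yamada's Theorem A (`gompfConjectureForTrace_neg_sixtyeight_of_undecided`).

Nothing here decides the four classes; no named fact is introduced (D-0026).  (File generated by the seat's
`gen_main.py` with the open-class hypotheses, lit-hodgefound p15, 2026-08-28.)

## References
* [Iwaki2025] K. Iwaki, Topology Appl. 366 (2025) 109293 (arXiv:2404.05096): §4.3 (Table, row `n = 73`: `38` classes),
  §5.1 (Lemma 5.2, the special classes; no chain for the trace `73`), Thm. 5.1 (the known traces).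
* [KimYamada2023] M. H. Kim, S. Yamada, Kyungpook Math. J. 63 (2023) 373–411: Lemma 6.1, Thm. A, Prop. 2.14.
-/

noncomputable section

open Set Polynomial Module NumberField Ideal
open scoped NumberField MatrixGroups nonZeroDivisors
open Literature.LinearAlgebra.Matrix

namespace Literature.Topology.FourManifolds

section Gompf

/-- **Gompf's conjecture for the trace `73`, inductive step by Iwaki's procedure (Lemma 5.2 = Kim–Yamada's Lemma 6.1), CONDITIONAL** (granted the
conjecture for the traces `-16`, `20`, `-13`, `16`, `-32`, `22`, `14`, `-22`, `19`, `-12`, `-17`, `-24`, `-14`, `-30`, `-8`, `-40` and the Gompf equivalence with `A₀` of the standard matrices of the undecided classes `(178, 191, 73)`, `(23, 145, 73)`, `(41, 189, 73)`, `(23, 171, 73)`): the non-trivial classes move by Gompf moves to the traces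
`-5` (from `(9, 13, 73)`), `-2` (from `(8, 15, 73)`), `-16` (from `(63, 89, 73)`), (UNDECIDED: `(178, 191, 73)`, hypothesis), `20` (from `(50, 53, 73)`), `-2` (from `(18, 25, 73)`), `-13` (from `(4, 43, 73)`), `10` (from `(41, 63, 73)`), (UNDECIDED: `(23, 145, 73)`, hypothesis), `3` (from `(6, 7, 73)`), `16` (from `(23, 57, 73)`), `-32` (from `(83, 105, 73)`), `22` (from `(14, 51, 73)`), `14` (from `(52, 59, 73)`), `-22` (from `(23, 95, 73)`), `19` (from `(14, 27, 73)`), `-12` (from `(48, 85, 73)`), `1` (from `(2, 3, 73)`), `-5` (from `(35, 39, 73)`), `-17` (from `(23, 45, 73)`), `-24` (from `(87, 97, 73)`), `-2` (from `(3, 5, 73)`), `8` (from `(48, 65, 73)`), `-2` (from `(68, 75, 73)`), `-14` (from `(23, 29, 73)`), (UNDECIDED: `(41, 189, 73)`, hypothesis), `4` (from `(14, 23, 73)`), `10` (from `(20, 21, 73)`), (UNDECIDED: `(23, 171, 73)`, hypothesis), `-30` (from `(29, 103, 73)`), `-3` (from `(4, 19, 73)`), `3` (from `(13, 35, 73)`),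 `5` (from `(14, 17, 73)`), `-8` (from `(68, 81, 73)`), `-40` (from `(50, 113, 73)`), `1` (from `(5, 9, 73)`), `11` (from `(21, 31, 73)`). [cite: Iwaki2025, §4.3 (Table, row n = 73) and §5.1 (Lemma 5.2; no chain is printed for the trace 73)] [cite: KimYamada2023, Lemma 6.1] -/
theorem gompfConjectureForTrace_seventythree_of
    (hneg16 : GompfConjectureForTrace (-16))
    (h20 : GompfConjectureForTrace (20))
    (hneg13 : GompfConjectureForTrace (-13))
    (h16 : GompfConjectureForTrace (16))
    (hneg32 : GompfConjectureForTrace (-32))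
    (h22 : GompfConjectureForTrace (22))
    (h14 : GompfConjectureForTrace (14))
    (hneg22 : GompfConjectureForTrace (-22))
    (h19 : GompfConjectureForTrace (19))
    (hneg12 : GompfConjectureForTrace (-12))
    (hneg17 : GompfConjectureForTrace (-17))
    (hneg24 : GompfConjectureForTrace (-24))
    (hneg14 : GompfConjectureForTrace (-14))
    (hneg30 : GompfConjectureForTrace (-30))
    (hneg8 : GompfConjectureForTrace (-8))
    (hneg40 : GompfConjectureForTrace (-40))
    (hX_178_191 : ∀ h : (191 : ℤ) ∣ (csPoly 73).eval 178, GompfEquiv (standardCSMatrix 178 191 73 h) akbulutKirbyMatrix)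
    (hX_23_145 : ∀ h : (145 : ℤ) ∣ (csPoly 73).eval 23, GompfEquiv (standardCSMatrix 23 145 73 h) akbulutKirbyMatrix)
    (hX_41_189 : ∀ h : (189 : ℤ) ∣ (csPoly 73).eval 41, GompfEquiv (standardCSMatrix 41 189 73 h) akbulutKirbyMatrix)
    (hX_23_171 : ∀ h : (171 : ℤ) ∣ (csPoly 73).eval 23, GompfEquiv (standardCSMatrix 23 171 73 h) akbulutKirbyMatrix) : GompfConjectureForTrace 73 := by
  intro A hdet htr
  rcases isConj_standardCSMatrix_of_trace_eq_seventythree A hdet htr with hc0 | hc1 | hc2 | hc3 | hc4 | hc5 | hc6 | hc7 | hc8 | hc9 | hc10 | hc11 | hc12 | hc13 | hc14 | hc15 | hc16 | hc17 | hc18 | hc19 | hc20 | hc21 | hc22 | hc23 | hc24 | hc25 | hc26 | hc27 | hc28 | hc29 | hc30 | hc31 | hc32 | hc33 | hc34 | hc35 | hc36 | hc37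
  · exact (GompfEquiv.of_isConj hc0).trans (gompfEquiv_standardCSMatrix_one_one 71 (one_dvd _))
  · exact (GompfEquiv.of_isConj hc1).trans
      (gompfEquiv_standardCSMatrix_akbulutKirbyMatrix_of_modEq
        (gompfConjectureForTrace_of_mem_Icc_neg_seven_twelve (by norm_num)) rep0_dvd_eval_csPoly_seventythree
        (show (73 : ℤ) ≡ -5 [ZMOD 13] by decide))
  · exact (GompfEquiv.of_isConj hc2).trans
      (gompfEquiv_standardCSMatrix_akbulutKirbyMatrix_of_modEq
        (gompfConjectureForTrace_of_mem_Icc_neg_seven_twelve (by norm_num)) rep1_dvd_eval_csPoly_seventythree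
        (show (73 : ℤ) ≡ -2 [ZMOD 15] by decide))
  · exact (GompfEquiv.of_isConj hc3).trans
      (gompfEquiv_standardCSMatrix_akbulutKirbyMatrix_of_modEq
        hneg16 rep2_dvd_eval_csPoly_seventythree
        (show (73 : ℤ) ≡ -16 [ZMOD 89] by decide))
  · exact (GompfEquiv.of_isConj hc4).trans (hX_178_191 _)
  · exact (GompfEquiv.of_isConj hc5).trans
      (gompfEquiv_standardCSMatrix_akbulutKirbyMatrix_of_modEq
        h20 rep4_dvd_eval_csPoly_seventythree
        (show (73 : ℤ) ≡ 20 [ZMOD 53] by decide))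
  · exact (GompfEquiv.of_isConj hc6).trans
      (gompfEquiv_standardCSMatrix_akbulutKirbyMatrix_of_modEq
        (gompfConjectureForTrace_of_mem_Icc_neg_seven_twelve (by norm_num)) rep5_dvd_eval_csPoly_seventythree
        (show (73 : ℤ) ≡ -2 [ZMOD 25] by decide))
  · exact (GompfEquiv.of_isConj hc7).trans
      (gompfEquiv_standardCSMatrix_akbulutKirbyMatrix_of_modEq
        hneg13 rep6_dvd_eval_csPoly_seventythree
        (show (73 : ℤ) ≡ -13 [ZMOD 43] by decide))
  · exact (GompfEquiv.of_isConj hc8).trans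
      (gompfEquiv_standardCSMatrix_akbulutKirbyMatrix_of_modEq
        (gompfConjectureForTrace_of_mem_Icc_neg_seven_twelve (by norm_num)) rep7_dvd_eval_csPoly_seventythree
        (show (73 : ℤ) ≡ 10 [ZMOD 63] by decide))
  · exact (GompfEquiv.of_isConj hc9).trans (hX_23_145 _)
  · exact (GompfEquiv.of_isConj hc10).trans
      (gompfEquiv_standardCSMatrix_akbulutKirbyMatrix_of_modEq
        (gompfConjectureForTrace_of_mem_Icc_neg_seven_twelve (by norm_num)) rep9_dvd_eval_csPoly_seventythree
        (show (73 : ℤ) ≡ 3 [ZMOD 7] by decide))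
  · exact (GompfEquiv.of_isConj hc11).trans
      (gompfEquiv_standardCSMatrix_akbulutKirbyMatrix_of_modEq
        h16 rep10_dvd_eval_csPoly_seventythree
        (show (73 : ℤ) ≡ 16 [ZMOD 57] by decide))
  · exact (GompfEquiv.of_isConj hc12).trans
      (gompfEquiv_standardCSMatrix_akbulutKirbyMatrix_of_modEq
        hneg32 rep11_dvd_eval_csPoly_seventythree
        (show (73 : ℤ) ≡ -32 [ZMOD 105] by decide))
  · exact (GompfEquiv.of_isConj hc13).trans
      (gompfEquiv_standardCSMatrix_akbulutKirbyMatrix_of_modEq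
        h22 rep12_dvd_eval_csPoly_seventythree
        (show (73 : ℤ) ≡ 22 [ZMOD 51] by decide))
  · exact (GompfEquiv.of_isConj hc14).trans
      (gompfEquiv_standardCSMatrix_akbulutKirbyMatrix_of_modEq
        h14 rep13_dvd_eval_csPoly_seventythree
        (show (73 : ℤ) ≡ 14 [ZMOD 59] by decide))
  · exact (GompfEquiv.of_isConj hc15).trans
      (gompfEquiv_standardCSMatrix_akbulutKirbyMatrix_of_modEq
        hneg22 rep14_dvd_eval_csPoly_seventythree
        (show (73 : ℤ) ≡ -22 [ZMOD 95] by decide))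
  · exact (GompfEquiv.of_isConj hc16).trans
      (gompfEquiv_standardCSMatrix_akbulutKirbyMatrix_of_modEq
        h19 rep15_dvd_eval_csPoly_seventythree
        (show (73 : ℤ) ≡ 19 [ZMOD 27] by decide))
  · exact (GompfEquiv.of_isConj hc17).trans
      (gompfEquiv_standardCSMatrix_akbulutKirbyMatrix_of_modEq
        hneg12 rep16_dvd_eval_csPoly_seventythree
        (show (73 : ℤ) ≡ -12 [ZMOD 85] by decide))
  · exact (GompfEquiv.of_isConj hc18).trans
      (gompfEquiv_standardCSMatrix_akbulutKirbyMatrix_of_modEq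
        (gompfConjectureForTrace_of_mem_Icc_neg_seven_twelve (by norm_num)) rep17_dvd_eval_csPoly_seventythree
        (show (73 : ℤ) ≡ 1 [ZMOD 3] by decide))
  · exact (GompfEquiv.of_isConj hc19).trans
      (gompfEquiv_standardCSMatrix_akbulutKirbyMatrix_of_modEq
        (gompfConjectureForTrace_of_mem_Icc_neg_seven_twelve (by norm_num)) rep18_dvd_eval_csPoly_seventythree
        (show (73 : ℤ) ≡ -5 [ZMOD 39] by decide))
  · exact (GompfEquiv.of_isConj hc20).trans
      (gompfEquiv_standardCSMatrix_akbulutKirbyMatrix_of_modEq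
        hneg17 rep19_dvd_eval_csPoly_seventythree
        (show (73 : ℤ) ≡ -17 [ZMOD 45] by decide))
  · exact (GompfEquiv.of_isConj hc21).trans
      (gompfEquiv_standardCSMatrix_akbulutKirbyMatrix_of_modEq
        hneg24 rep20_dvd_eval_csPoly_seventythree
        (show (73 : ℤ) ≡ -24 [ZMOD 97] by decide))
  · exact (GompfEquiv.of_isConj hc22).trans
      (gompfEquiv_standardCSMatrix_akbulutKirbyMatrix_of_modEq
        (gompfConjectureForTrace_of_mem_Icc_neg_seven_twelve (by norm_num)) rep21_dvd_eval_csPoly_seventythree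
        (show (73 : ℤ) ≡ -2 [ZMOD 5] by decide))
  · exact (GompfEquiv.of_isConj hc23).trans
      (gompfEquiv_standardCSMatrix_akbulutKirbyMatrix_of_modEq
        (gompfConjectureForTrace_of_mem_Icc_neg_seven_twelve (by norm_num)) rep22_dvd_eval_csPoly_seventythree
        (show (73 : ℤ) ≡ 8 [ZMOD 65] by decide))
  · exact (GompfEquiv.of_isConj hc24).trans
      (gompfEquiv_standardCSMatrix_akbulutKirbyMatrix_of_modEq
        (gompfConjectureForTrace_of_mem_Icc_neg_seven_twelve (by norm_num)) rep23_dvd_eval_csPoly_seventythree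
        (show (73 : ℤ) ≡ -2 [ZMOD 75] by decide))
  · exact (GompfEquiv.of_isConj hc25).trans
      (gompfEquiv_standardCSMatrix_akbulutKirbyMatrix_of_modEq
        hneg14 rep24_dvd_eval_csPoly_seventythree
        (show (73 : ℤ) ≡ -14 [ZMOD 29] by decide))
  · exact (GompfEquiv.of_isConj hc26).trans (hX_41_189 _)
  · exact (GompfEquiv.of_isConj hc27).trans
      (gompfEquiv_standardCSMatrix_akbulutKirbyMatrix_of_modEq
        (gompfConjectureForTrace_of_mem_Icc_neg_seven_twelve (by norm_num)) rep26_dvd_eval_csPoly_seventythree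
        (show (73 : ℤ) ≡ 4 [ZMOD 23] by decide))
  · exact (GompfEquiv.of_isConj hc28).trans
      (gompfEquiv_standardCSMatrix_akbulutKirbyMatrix_of_modEq
        (gompfConjectureForTrace_of_mem_Icc_neg_seven_twelve (by norm_num)) rep27_dvd_eval_csPoly_seventythree
        (show (73 : ℤ) ≡ 10 [ZMOD 21] by decide))
  · exact (GompfEquiv.of_isConj hc29).trans (hX_23_171 _)
  · exact (GompfEquiv.of_isConj hc30).trans
      (gompfEquiv_standardCSMatrix_akbulutKirbyMatrix_of_modEq
        hneg30 rep29_dvd_eval_csPoly_seventythree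
        (show (73 : ℤ) ≡ -30 [ZMOD 103] by decide))
  · exact (GompfEquiv.of_isConj hc31).trans
      (gompfEquiv_standardCSMatrix_akbulutKirbyMatrix_of_modEq
        (gompfConjectureForTrace_of_mem_Icc_neg_seven_twelve (by norm_num)) rep30_dvd_eval_csPoly_seventythree
        (show (73 : ℤ) ≡ -3 [ZMOD 19] by decide))
  · exact (GompfEquiv.of_isConj hc32).trans
      (gompfEquiv_standardCSMatrix_akbulutKirbyMatrix_of_modEq
        (gompfConjectureForTrace_of_mem_Icc_neg_seven_twelve (by norm_num)) rep31_dvd_eval_csPoly_seventythree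
        (show (73 : ℤ) ≡ 3 [ZMOD 35] by decide))
  · exact (GompfEquiv.of_isConj hc33).trans
      (gompfEquiv_standardCSMatrix_akbulutKirbyMatrix_of_modEq
        (gompfConjectureForTrace_of_mem_Icc_neg_seven_twelve (by norm_num)) rep32_dvd_eval_csPoly_seventythree
        (show (73 : ℤ) ≡ 5 [ZMOD 17] by decide))
  · exact (GompfEquiv.of_isConj hc34).trans
      (gompfEquiv_standardCSMatrix_akbulutKirbyMatrix_of_modEq
        hneg8 rep33_dvd_eval_csPoly_seventythree
        (show (73 : ℤ) ≡ -8 [ZMOD 81] by decide))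
  · exact (GompfEquiv.of_isConj hc35).trans
      (gompfEquiv_standardCSMatrix_akbulutKirbyMatrix_of_modEq
        hneg40 rep34_dvd_eval_csPoly_seventythree
        (show (73 : ℤ) ≡ -40 [ZMOD 113] by decide))
  · exact (GompfEquiv.of_isConj hc36).trans
      (gompfEquiv_standardCSMatrix_akbulutKirbyMatrix_of_modEq
        (gompfConjectureForTrace_of_mem_Icc_neg_seven_twelve (by norm_num)) rep35_dvd_eval_csPoly_seventythree
        (show (73 : ℤ) ≡ 1 [ZMOD 9] by decide))
  · exact (GompfEquiv.of_isConj hc37).trans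
      (gompfEquiv_standardCSMatrix_akbulutKirbyMatrix_of_modEq
        (gompfConjectureForTrace_of_mem_Icc_neg_seven_twelve (by norm_num)) rep36_dvd_eval_csPoly_seventythree
        (show (73 : ℤ) ≡ 11 [ZMOD 31] by decide))

/-- **The trace `-68`** (`= 5 - 73`), by Kim–Yamada's Theorem A, under the same hypotheses. [cite: KimYamada2023, Thm. A] [cite: Iwaki2025, §5.1] -/
theorem gompfConjectureForTrace_neg_sixtyeight_of
    (hneg16 : GompfConjectureForTrace (-16))
    (h20 : GompfConjectureForTrace (20))
    (hneg13 : GompfConjectureForTrace (-13))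
    (h16 : GompfConjectureForTrace (16))
    (hneg32 : GompfConjectureForTrace (-32))
    (h22 : GompfConjectureForTrace (22))
    (h14 : GompfConjectureForTrace (14))
    (hneg22 : GompfConjectureForTrace (-22))
    (h19 : GompfConjectureForTrace (19))
    (hneg12 : GompfConjectureForTrace (-12))
    (hneg17 : GompfConjectureForTrace (-17))
    (hneg24 : GompfConjectureForTrace (-24))
    (hneg14 : GompfConjectureForTrace (-14))
    (hneg30 : GompfConjectureForTrace (-30))
    (hneg8 : GompfConjectureForTrace (-8))
    (hneg40 : GompfConjectureForTrace (-40))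
    (hX_178_191 : ∀ h : (191 : ℤ) ∣ (csPoly 73).eval 178, GompfEquiv (standardCSMatrix 178 191 73 h) akbulutKirbyMatrix)
    (hX_23_145 : ∀ h : (145 : ℤ) ∣ (csPoly 73).eval 23, GompfEquiv (standardCSMatrix 23 145 73 h) akbulutKirbyMatrix)
    (hX_41_189 : ∀ h : (189 : ℤ) ∣ (csPoly 73).eval 41, GompfEquiv (standardCSMatrix 41 189 73 h) akbulutKirbyMatrix)
    (hX_23_171 : ∀ h : (171 : ℤ) ∣ (csPoly 73).eval 23, GompfEquiv (standardCSMatrix 23 171 73 h) akbulutKirbyMatrix) : GompfConjectureForTrace (-68) := by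
  have h := gompfConjectureForTrace_of_five_sub (gompfConjectureForTrace_seventythree_of hneg16 h20 hneg13 h16 hneg32 h22 h14 hneg22 h19 hneg12 hneg17 hneg24 hneg14 hneg30 hneg8 hneg40 hX_178_191 hX_23_145 hX_41_189 hX_23_171)
  norm_num at h
  exact h

/-- **Gompf's conjecture for the trace `73` from Iwaki's four undecided classes alone**: every smaller-trace
hypothesis of `gompfConjectureForTrace_seventythree_of` is a theorem of the tree
(`gompfConjectureForTrace_neg_sixteen`, `gompfConjectureForTrace_twenty`, `gompfConjectureForTrace_neg_thirteen`, `gompfConjectureForTrace_sixteen`, `gompfConjectureForTrace_neg_thirtytwo`, `gompfConjectureForTrace_twentytwo`, `gompfConjectureForTrace_fourteen`, `gompfConjectureForTrace_neg_twentytwo`, `gompfConjectureForTrace_nineteen`, `gompfConjectureForTrace_neg_twelve`, `gompfConjectureForTrace_neg_seventeen`, `gompfConjectureForTrace_neg_twentyfour`, `gompfConjectureForTrace_neg_fourteen`, `gompfConjectureForTrace_neg_thirty`, `gompfConjectureForTrace_neg_eight`, `gompfConjectureForTrace_neg_forty`), so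
`GompfConjectureForTrace 73` follows from `X_{178,191,73} ∼ A₀`, `X_{23,145,73} ∼ A₀`, `X_{41,189,73} ∼ A₀`, `X_{23,171,73} ∼ A₀` (the four special
classes of the trace `73`, Iwaki 2025, §4.3 ∕ §5.1, for which no chain is printed). [cite: Iwaki2025, §5.1 and §4.3 (Table, row 73)] -/
theorem gompfConjectureForTrace_seventythree_of_undecided
    (h₁ : ∀ h : (191 : ℤ) ∣ (csPoly 73).eval 178, GompfEquiv (standardCSMatrix 178 191 73 h) akbulutKirbyMatrix)
    (h₂ : ∀ h : (145 : ℤ) ∣ (csPoly 73).eval 23, GompfEquiv (standardCSMatrix 23 145 73 h) akbulutKirbyMatrix)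
    (h₃ : ∀ h : (189 : ℤ) ∣ (csPoly 73).eval 41, GompfEquiv (standardCSMatrix 41 189 73 h) akbulutKirbyMatrix)
    (h₄ : ∀ h : (171 : ℤ) ∣ (csPoly 73).eval 23, GompfEquiv (standardCSMatrix 23 171 73 h) akbulutKirbyMatrix) :
    GompfConjectureForTrace 73 :=
  gompfConjectureForTrace_seventythree_of gompfConjectureForTrace_neg_sixteen gompfConjectureForTrace_twenty gompfConjectureForTrace_neg_thirteen gompfConjectureForTrace_sixteen gompfConjectureForTrace_neg_thirtytwo gompfConjectureForTrace_twentytwo gompfConjectureForTrace_fourteen gompfConjectureForTrace_neg_twentytwo gompfConjectureForTrace_nineteen gompfConjectureForTrace_neg_twelve gompfConjectureForTrace_neg_seventeen gompfConjectureForTrace_neg_twentyfour gompfConjectureForTrace_neg_fourteen gompfConjectureForTrace_neg_thirty gompfConjectureForTrace_neg_eight gompfConjectureForTrace_neg_forty h₁ h₂ h₃ h₄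

/-- **The trace `-68 = 5 - 73` from the same four classes**, by Kim–Yamada's Theorem A. [cite: KimYamada2023, Thm. A] [cite: Iwaki2025, §5.1] -/
theorem gompfConjectureForTrace_neg_sixtyeight_of_undecided
    (h₁ : ∀ h : (191 : ℤ) ∣ (csPoly 73).eval 178, GompfEquiv (standardCSMatrix 178 191 73 h) akbulutKirbyMatrix)
    (h₂ : ∀ h : (145 : ℤ) ∣ (csPoly 73).eval 23, GompfEquiv (standardCSMatrix 23 145 73 h) akbulutKirbyMatrix)
    (h₃ : ∀ h : (189 : ℤ) ∣ (csPoly 73).eval 41, GompfEquiv (standardCSMatrix 41 189 73 h) akbulutKirbyMatrix)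
    (h₄ : ∀ h : (171 : ℤ) ∣ (csPoly 73).eval 23, GompfEquiv (standardCSMatrix 23 171 73 h) akbulutKirbyMatrix) :
    GompfConjectureForTrace (-68) :=
  gompfConjectureForTrace_neg_sixtyeight_of gompfConjectureForTrace_neg_sixteen gompfConjectureForTrace_twenty gompfConjectureForTrace_neg_thirteen gompfConjectureForTrace_sixteen gompfConjectureForTrace_neg_thirtytwo gompfConjectureForTrace_twentytwo gompfConjectureForTrace_fourteen gompfConjectureForTrace_neg_twentytwo gompfConjectureForTrace_nineteen gompfConjectureForTrace_neg_twelve gompfConjectureForTrace_neg_seventeen gompfConjectureForTrace_neg_twentyfour gompfConjectureForTrace_neg_fourteen gompfConjectureForTrace_neg_thirty gompfConjectureForTrace_neg_eight gompfConjectureForTrace_neg_forty h₁ h₂ h₃ h₄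

/-- **Gompf's conjecture for the trace `73` ⟺ the four undecided standard matrices `X_{178,191,73}`, `X_{23,145,73}`,
`X_{41,189,73}`, `X_{23,171,73}` are Gompf equivalent to `A₀`** (⇒ is the conjecture applied to these matrices,
`GompfConjectureForTrace.standardCSMatrix`). [cite: Iwaki2025, §5.1 and §4.3 (Table, row 73)] -/
theorem gompfConjectureForTrace_seventythree_iff :
    GompfConjectureForTrace 73 ↔
      (∀ h : (191 : ℤ) ∣ (csPoly 73).eval 178, GompfEquiv (standardCSMatrix 178 191 73 h) akbulutKirbyMatrix) ∧
        (∀ h : (145 : ℤ) ∣ (csPoly 73).eval 23, GompfEquiv (standardCSMatrix 23 145 73 h) akbulutKirbyMatrix) ∧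
        (∀ h : (189 : ℤ) ∣ (csPoly 73).eval 41, GompfEquiv (standardCSMatrix 41 189 73 h) akbulutKirbyMatrix) ∧
        ∀ h : (171 : ℤ) ∣ (csPoly 73).eval 23, GompfEquiv (standardCSMatrix 23 171 73 h) akbulutKirbyMatrix :=
  ⟨fun hG => ⟨fun h => hG.standardCSMatrix h, fun h => hG.standardCSMatrix h, fun h => hG.standardCSMatrix h,
      fun h => hG.standardCSMatrix h⟩,
    fun h => gompfConjectureForTrace_seventythree_of_undecided h.1 h.2.1 h.2.2.1 h.2.2.2⟩

/-- **`(178, 191, 73)`, `(23, 145, 73)`, `(41, 189, 73)`, `(23, 171, 73)` are Cappell–Shaneson triples** (`191 ∣ f₇₃(178)`,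
`145 ∣ f₇₃(23)`, `189 ∣ f₇₃(41)`, `171 ∣ f₇₃(23)`): the four undecided standard matrices exist. [cite: Iwaki2025, §4.3 (Table, row 73)] -/
theorem dvd_eval_csPoly_seventythree_undecided :
    (191 : ℤ) ∣ (csPoly 73).eval 178 ∧ (145 : ℤ) ∣ (csPoly 73).eval 23 ∧ (189 : ℤ) ∣ (csPoly 73).eval 41 ∧
      (171 : ℤ) ∣ (csPoly 73).eval 23 := by
  refine ⟨?_, ?_, ?_, ?_⟩ <;> norm_num [eval_csPoly]

end Gompf

end Literature.Topology.FourManifolds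

end
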